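import Summits.BirchSwinnertonDyer.Rank1Residual.P2.CongruentNumberPairsAtTwo
import HarnessLib

/-!
# Sub-lane «bsd-p2»: PAIRS `(E_n, 2)` CLOSED IN THE KERNEL — the TABLE ROUTE (any `k`) and the first
# slice of the R0 pilot (`pilot100`, rows 1–14); p2-lead QUEUE v2 (ii), generator by p2-monsky-eng

HONEST FRAMING (sub-lane «bsd-p2», run/shared/lean/b2b/bsd-rank1-residual/p2/, verbatim in every
file): the target of record is the FULL Birch–Swinnerton-Dyer formula for EVERY analytic-rank `≤ 1`
`E/ℚ` at ALL primes INCLUDING `2`; the odd-prime class ledger is referee A's; the `2`-part is OPEN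
(cells O1 = X5 ∖ CM and O12 = the CM corner) and under census by «bsd-p2». Census / instrument
output at `2` = EVIDENCE / conjecture items with held-out validation, NEVER a Literature fact;
certificates close PAIRS (one isogeny class, `p = 2`), never classes. This file asserts NO
arithmetic fact. CREDIT: §0 and the instance certificates are GENERATED by p2-monsky-eng
(`p2/monsky/eng/lean/gen3/monsky_cert_gen_v3.py`, `Pilot100.lean` @c5710646, farm rc 0, README §1);
the typer (one writer of `P2/**`) places them, owning wording and the proposal (p2-lead T-42 §0
DEFAULT, QUEUE v2 (ii)). THE TABLE ROUTE: Monsky's matrix is assembled from a `k × k` TABLE of additive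
Legendre bits plus two diagonal bit vectors (explicit `Matrix.fromBlocks`/`Matrix.of` terms, no new
definitions); if the `k² + 2k` symbol values agree with the tables (`norm_num` on each Jacobi
symbol, Mathlib's extension) the defined matrix IS the table matrix, and an explicit `𝔽₂`-inverse
`N` with `M·N = 1` checked by `decide` gives `det M = 1` (`det_monskyMatrix{Odd,Even}_of_table`) —
this scales to every `k` where the entry-by-entry `ext; fin_cases` recipe of
`P2/CongruentNumberPairsAtTwo{Odd,Even}.lean` times out for `k ≥ 4` (eng's farm finding). Then
`BSD(E_n, 2)` through the JOURNAL door `bsdp_two_congruentNumberCurve_of_det_odd/even` modulo Monsky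
1994, Burungale–Tian 2026 Thm 1.1, Deuring–Hecke, Burungale–Flach 2024 Cor 2 (binders). ROWS of this
slice (MONSKY-TABLE v1.1 of record @03a0f526, `fam = R0`, `s = 0`, `k ≥ 3`, conductor up to
`32·(3·10⁶)²` — OUT of the `U_CN` range: these are census rows, kernel-certified as PAIRS):
n ∈ {30657, 84738, 93651, 136713, 189442, 229530, 242169, 293995, 345466, 350715, 396019, 441210, 445811, 466890}. Cells `coveredC8`; pairs not classes. Nothing booked; no mark moved. Unit
`b2b-bsdres-p2-typer` GEN 3; NEW file (sequel slices `…TableB/C/…` carry the remaining pilot rows,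
≤ 20 per file).

References: Heath-Brown 1994 Appendix (Monsky) [HeathBrown1994SelmerCongruentII]; [BurungaleTian2026]
Thm 1.1; [BurungaleFlach2024] Cor 2; [Miller2011LMS] Def 1.1; HOME/p2/monsky/eng/lean/gen3/README.md §1.
-/

noncomputable section

open scoped Classical

open Matrix WeierstrassCurve Literature.NumberTheory.EllipticCurves
  Literature.NumberTheory.EllipticCurves.HeathBrown1994

set_option autoImplicit false

namespace Summit.BirchSwinnertonDyer.Rank1Residual.P2

/-! ## §0 The TABLE ROUTE (p2-monsky-eng's `monsky_cert_gen_v3.py` §0, placed with the table matrices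
INLINED as explicit terms — no new definitions; proved once) -/

section TableRoute

variable {k : ℕ} (p : Fin k → ℕ)

/-- If the symbol values agree with a TABLE `L` of additive Legendre bits (`L i j = [(p_j/p_i) ≠ 1]`),
Monsky's `A = legendreMatrix p` IS the table matrix (off-diagonal entries from the table, diagonal =
row sum of the off-diagonal table entries). (p2-monsky-eng, table route.) [folklore] -/
theorem legendreMatrix_eq_ofTable (L : Fin k → Fin k → ZMod 2)
    (hL : ∀ i j, addLegendreSym (p j) (p i) = L i j) :
    legendreMatrix p =
      Matrix.of (fun i j => if i = j then ∑ l ∈ Finset.univ.erase i, L i l else L i j) := by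
  ext i j
  simp only [legendreMatrix, Matrix.of_apply]
  split_ifs with h
  · exact Finset.sum_congr rfl fun l _ => hL i l
  · exact hL i j

/-- If the symbol values agree with the bit vector `d`, `legendreDiagonal p a` IS `diagonal d`.
(p2-monsky-eng, table route.) [folklore] -/
theorem legendreDiagonal_eq_ofTable (a : ℤ) (d : Fin k → ZMod 2)
    (hd : ∀ i, addLegendreSym a (p i) = d i) : legendreDiagonal p a = Matrix.diagonal d := by
  unfold legendreDiagonal
  exact congrArg Matrix.diagonal (funext hd)

/-- Over `ℤ/2` a right inverse forces `det = 1` (`det M · det N = 1` in `ℤ/2`). [folklore] -/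
theorem det_eq_one_of_mul_eq_one_zmod2 {m : Type*} [Fintype m] [DecidableEq m]
    (M N : Matrix m m (ZMod 2)) (h : M * N = 1) : M.det = 1 := by
  have hd : M.det * N.det = 1 := by rw [← Matrix.det_mul, h, Matrix.det_one]
  have : ∀ a b : ZMod 2, a * b = 1 → a = 1 := by decide
  exact this _ _ hd

/-- **TABLE ROUTE, odd `n`** (p2-monsky-eng): certified symbol tables `L`, `d2 = [(2/pᵢ) ≠ 1]`,
`dm2 = [(−2/pᵢ) ≠ 1]` + an explicit `𝔽₂` inverse `N` of the table matrix ⇒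
`det (monskyMatrixOdd p) = 1`. [cite: HeathBrown1994SelmerCongruentII, Appendix (Monsky), typescript p. 39 L27–L33] -/
theorem det_monskyMatrixOdd_of_table (L : Fin k → Fin k → ZMod 2) (d2 dm2 : Fin k → ZMod 2)
    (N : Matrix (Fin k ⊕ Fin k) (Fin k ⊕ Fin k) (ZMod 2))
    (hL : ∀ i j, addLegendreSym (p j) (p i) = L i j) (h2 : ∀ i, addLegendreSym 2 (p i) = d2 i)
    (hm2 : ∀ i, addLegendreSym (-2) (p i) = dm2 i)
    (hN : Matrix.fromBlocks
        (Matrix.of (fun i j => if i = j then ∑ l ∈ Finset.univ.erase i, L i l else L i j) +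
          Matrix.diagonal d2) (Matrix.diagonal d2) (Matrix.diagonal d2)
        (Matrix.of (fun i j => if i = j then ∑ l ∈ Finset.univ.erase i, L i l else L i j) +
          Matrix.diagonal dm2) * N = 1) :
    (monskyMatrixOdd p).det = 1 := by
  have e : monskyMatrixOdd p = Matrix.fromBlocks
      (Matrix.of (fun i j => if i = j then ∑ l ∈ Finset.univ.erase i, L i l else L i j) +
        Matrix.diagonal d2) (Matrix.diagonal d2) (Matrix.diagonal d2)
      (Matrix.of (fun i j => if i = j then ∑ l ∈ Finset.univ.erase i, L i l else L i j) +
        Matrix.diagonal dm2) := by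
    simp only [monskyMatrixOdd, legendreMatrix_eq_ofTable p L hL,
      legendreDiagonal_eq_ofTable p 2 d2 h2, legendreDiagonal_eq_ofTable p (-2) dm2 hm2]
  rw [e]
  exact det_eq_one_of_mul_eq_one_zmod2 _ N hN

/-- **TABLE ROUTE, even `n`** (p2-monsky-eng): certified tables `L`, `d2`, `dm1 = [(−1/pᵢ) ≠ 1]` + an
explicit `𝔽₂` inverse ⇒ `det (monskyMatrixEven p) = 1`. [cite: HeathBrown1994SelmerCongruentII, Appendix (Monsky), typescript p. 41 L20–L36] -/
theorem det_monskyMatrixEven_of_table (L : Fin k → Fin k → ZMod 2) (d2 dm1 : Fin k → ZMod 2)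
    (N : Matrix (Fin k ⊕ Fin k) (Fin k ⊕ Fin k) (ZMod 2))
    (hL : ∀ i j, addLegendreSym (p j) (p i) = L i j) (h2 : ∀ i, addLegendreSym 2 (p i) = d2 i)
    (hm1 : ∀ i, addLegendreSym (-1) (p i) = dm1 i)
    (hN : Matrix.fromBlocks
        ((Matrix.of (fun i j => if i = j then ∑ l ∈ Finset.univ.erase i, L i l else L i j))ᵀ +
          Matrix.diagonal d2) (Matrix.diagonal dm1) (Matrix.diagonal d2)
        (Matrix.of (fun i j => if i = j then ∑ l ∈ Finset.univ.erase i, L i l else L i j) +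
          Matrix.diagonal d2) * N = 1) :
    (monskyMatrixEven p).det = 1 := by
  have e : monskyMatrixEven p = Matrix.fromBlocks
      ((Matrix.of (fun i j => if i = j then ∑ l ∈ Finset.univ.erase i, L i l else L i j))ᵀ +
        Matrix.diagonal d2) (Matrix.diagonal dm1) (Matrix.diagonal d2)
      (Matrix.of (fun i j => if i = j then ∑ l ∈ Finset.univ.erase i, L i l else L i j) +
        Matrix.diagonal d2) := by
    simp only [monskyMatrixEven, legendreMatrix_eq_ofTable p L hL,
      legendreDiagonal_eq_ofTable p 2 d2 h2, legendreDiagonal_eq_ofTable p (-1) dm1 hm1]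
  rw [e]
  exact det_eq_one_of_mul_eq_one_zmod2 _ N hN

end TableRoute

/-! ## §1 Instances (batch `pilot100`, rows 1–14; generated by p2-monsky-eng) -/

/-- `n = 30657` = 3 · 11 · 929: `n ≡ 1 (mod 8)`, conductor `32·30657²`; Monsky's matrix (odd case, `k = 3`) has rows `111100;010010;101000;100011;010000;000101` and `det M = 1`, i.e. `s(30657) = 0` (table route: Legendre bits by `norm_num`, inverse certificate by `decide`). [cite: HeathBrown1994SelmerCongruentII, Appendix (Monsky), typescript p. 39 L10–L33] -/
theorem det_monskyMatrixOdd_30657 : (monskyMatrixOdd ![3, 11, 929]).det = 1 :=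
  det_monskyMatrixOdd_of_table ![3, 11, 929] ![![1, 1, 1], ![0, 1, 0], ![1, 0, 1]] ![1, 1, 0] ![0, 0, 0]
    (Matrix.fromBlocks !![1, 1, 1; 0, 0, 0; 1, 1, 0] !![1, 0, 1; 0, 1, 0; 1, 0, 1] !![1, 0, 1; 0, 1, 0; 1, 0, 1] !![0, 1, 0; 0, 1, 0; 0, 1, 1])
    (by intro i j; fin_cases i <;> fin_cases j <;> norm_num [addLegendreSym, Matrix.cons_val_zero, Matrix.cons_val_one, Matrix.cons_val_two, Matrix.cons_val_succ, Matrix.head_cons, Matrix.cons_val_fin_one])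
    (by intro i; fin_cases i <;> norm_num [addLegendreSym, Matrix.cons_val_zero, Matrix.cons_val_one, Matrix.cons_val_two, Matrix.cons_val_succ, Matrix.head_cons, Matrix.cons_val_fin_one])
    (by intro i; fin_cases i <;> norm_num [addLegendreSym, Matrix.cons_val_zero, Matrix.cons_val_one, Matrix.cons_val_two, Matrix.cons_val_succ, Matrix.head_cons, Matrix.cons_val_fin_one])
    (by decide)

/-- **`BSD(E_{30657}, 2)`** (`y² = x³ − 30657²x`, conductor `32·30657²`), journal door: Monsky (`hM`) + Burungale–Tian (`hBT`) + Deuring–Hecke (`hH`) + Burungale–Flach (`hBF`); membership `s(30657) = 0` by `det_monskyMatrixOdd_30657`. [cite: BurungaleTian2026, Thm. 1.1] [cite: BurungaleFlach2024, Cor. 2] [cite: Miller2011LMS, Def. 1.1] -/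
theorem bsdp_two_congruentNumberCurve_30657 (hM : monsky_card_selmerGroup_two_odd)
    (hBT : burungaleTian_analyticRank_eq_zero_of_selmerCorank_eq_zero_of_hasCM)
    (hH : hasEntireLFunction_of_j_mem_maximalCMJInvariants)
    (hBF : bsdTriple_of_hasCM_of_L_one_ne_zero) : BSDp (congruentNumberCurve 30657) 2 :=
  bsdp_two_congruentNumberCurve_of_det_odd ![3, 11, 929] hM hBT hH hBF
    (by intro i; fin_cases i <;> norm_num) (by intro i; fin_cases i <;> decide) (by decide)
    det_monskyMatrixOdd_30657 (by simp [Fin.prod_univ_succ])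

/-- `n = 84738` = 2 · 3 · 29 · 487: `n ≡ 2 (mod 8)`, conductor `16·84738²`; Monsky's matrix (even case, `k = 3`) has rows `011100;100000;001001;100010;010100;000101` and `det M = 1`, i.e. `s(84738) = 0` (table route: Legendre bits by `norm_num`, inverse certificate by `decide`). [cite: HeathBrown1994SelmerCongruentII, Appendix (Monsky), typescript p. 41 L20–L36] -/
theorem det_monskyMatrixEven_84738 : (monskyMatrixEven ![3, 29, 487]).det = 1 :=
  det_monskyMatrixEven_of_table ![3, 29, 487] ![![1, 1, 0], ![1, 1, 0], ![1, 0, 1]] ![1, 1, 0] ![1, 0, 1]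
    (Matrix.fromBlocks !![0, 1, 0; 1, 0, 1; 1, 0, 0] !![0, 0, 0; 0, 0, 1; 0, 1, 0] !![1, 0, 1; 0, 1, 0; 1, 0, 1] !![0, 1, 1; 1, 0, 0; 0, 1, 0])
    (by intro i j; fin_cases i <;> fin_cases j <;> norm_num [addLegendreSym, Matrix.cons_val_zero, Matrix.cons_val_one, Matrix.cons_val_two, Matrix.cons_val_succ, Matrix.head_cons, Matrix.cons_val_fin_one])
    (by intro i; fin_cases i <;> norm_num [addLegendreSym, Matrix.cons_val_zero, Matrix.cons_val_one, Matrix.cons_val_two, Matrix.cons_val_succ, Matrix.head_cons, Matrix.cons_val_fin_one])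
    (by intro i; fin_cases i <;> norm_num [addLegendreSym, Matrix.cons_val_zero, Matrix.cons_val_one, Matrix.cons_val_two, Matrix.cons_val_succ, Matrix.head_cons, Matrix.cons_val_fin_one])
    (by decide)

/-- **`BSD(E_{84738}, 2)`** (`y² = x³ − 84738²x`, conductor `16·84738²`), journal door: Monsky (`hM`) + Burungale–Tian (`hBT`) + Deuring–Hecke (`hH`) + Burungale–Flach (`hBF`); membership `s(84738) = 0` by `det_monskyMatrixEven_84738`. [cite: BurungaleTian2026, Thm. 1.1] [cite: BurungaleFlach2024, Cor. 2] [cite: Miller2011LMS, Def. 1.1] -/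
theorem bsdp_two_congruentNumberCurve_84738 (hM : monsky_card_selmerGroup_two_even)
    (hBT : burungaleTian_analyticRank_eq_zero_of_selmerCorank_eq_zero_of_hasCM)
    (hH : hasEntireLFunction_of_j_mem_maximalCMJInvariants)
    (hBF : bsdTriple_of_hasCM_of_L_one_ne_zero) : BSDp (congruentNumberCurve 84738) 2 :=
  bsdp_two_congruentNumberCurve_of_det_even ![3, 29, 487] hM hBT hH hBF
    (by intro i; fin_cases i <;> norm_num) (by intro i; fin_cases i <;> decide) (by decide)
    det_monskyMatrixEven_84738 (by simp [Fin.prod_univ_succ])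

/-- `n = 93651` = 3 · 19 · 31 · 53: `n ≡ 3 (mod 8)`, conductor `32·93651²`; Monsky's matrix (odd case, `k = 4`) has rows `00011000;10110100;10010000;11100001;10001001;01001111;00001011;00011110` and `det M = 1`, i.e. `s(93651) = 0` (table route: Legendre bits by `norm_num`, inverse certificate by `decide`). [cite: HeathBrown1994SelmerCongruentII, Appendix (Monsky), typescript p. 39 L10–L33] -/
theorem det_monskyMatrixOdd_93651 : (monskyMatrixOdd ![3, 19, 31, 53]).det = 1 :=
  det_monskyMatrixOdd_of_table ![3, 19, 31, 53] ![![1, 0, 0, 1], ![1, 1, 1, 1], ![1, 0, 1, 1], ![1, 1, 1, 1]] ![1, 1, 0, 1] ![0, 0, 1, 1]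
    (Matrix.fromBlocks !![1, 1, 0, 1; 0, 1, 0, 1; 0, 0, 1, 1; 1, 1, 1, 1] !![1, 1, 1, 0; 0, 0, 1, 1; 0, 1, 0, 1; 1, 1, 1, 0] !![0, 1, 1, 1; 0, 1, 0, 1; 1, 1, 0, 1; 1, 0, 1, 0] !![1, 1, 1, 0; 0, 1, 0, 1; 0, 1, 0, 0; 1, 0, 0, 0])
    (by intro i j; fin_cases i <;> fin_cases j <;> norm_num [addLegendreSym, Matrix.cons_val_zero, Matrix.cons_val_one, Matrix.cons_val_two, Matrix.cons_val_succ, Matrix.head_cons, Matrix.cons_val_fin_one])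
    (by intro i; fin_cases i <;> norm_num [addLegendreSym, Matrix.cons_val_zero, Matrix.cons_val_one, Matrix.cons_val_two, Matrix.cons_val_succ, Matrix.head_cons, Matrix.cons_val_fin_one])
    (by intro i; fin_cases i <;> norm_num [addLegendreSym, Matrix.cons_val_zero, Matrix.cons_val_one, Matrix.cons_val_two, Matrix.cons_val_succ, Matrix.head_cons, Matrix.cons_val_fin_one])
    (by decide)

/-- **`BSD(E_{93651}, 2)`** (`y² = x³ − 93651²x`, conductor `32·93651²`), journal door: Monsky (`hM`) + Burungale–Tian (`hBT`) + Deuring–Hecke (`hH`) + Burungale–Flach (`hBF`); membership `s(93651) = 0` by `det_monskyMatrixOdd_93651`. [cite: BurungaleTian2026, Thm. 1.1] [cite: BurungaleFlach2024, Cor. 2] [cite: Miller2011LMS, Def. 1.1] -/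
theorem bsdp_two_congruentNumberCurve_93651 (hM : monsky_card_selmerGroup_two_odd)
    (hBT : burungaleTian_analyticRank_eq_zero_of_selmerCorank_eq_zero_of_hasCM)
    (hH : hasEntireLFunction_of_j_mem_maximalCMJInvariants)
    (hBF : bsdTriple_of_hasCM_of_L_one_ne_zero) : BSDp (congruentNumberCurve 93651) 2 :=
  bsdp_two_congruentNumberCurve_of_det_odd ![3, 19, 31, 53] hM hBT hH hBF
    (by intro i; fin_cases i <;> norm_num) (by intro i; fin_cases i <;> decide) (by decide)
    det_monskyMatrixOdd_93651 (by simp [Fin.prod_univ_succ])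

/-- `n = 136713` = 3 · 199 · 229: `n ≡ 1 (mod 8)`, conductor `32·136713²`; Monsky's matrix (odd case, `k = 3`) has rows `100100;101000;010001;100000;000111;001010` and `det M = 1`, i.e. `s(136713) = 0` (table route: Legendre bits by `norm_num`, inverse certificate by `decide`). [cite: HeathBrown1994SelmerCongruentII, Appendix (Monsky), typescript p. 39 L10–L33] -/
theorem det_monskyMatrixOdd_136713 : (monskyMatrixOdd ![3, 199, 229]).det = 1 :=
  det_monskyMatrixOdd_of_table ![3, 199, 229] ![![1, 0, 0], ![1, 1, 1], ![0, 1, 1]] ![1, 0, 1] ![0, 1, 1]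
    (Matrix.fromBlocks !![0, 0, 0; 1, 1, 1; 0, 1, 0] !![1, 0, 0; 0, 1, 1; 1, 0, 0] !![1, 0, 0; 0, 1, 0; 1, 1, 0] !![1, 0, 0; 1, 0, 1; 0, 1, 1])
    (by intro i j; fin_cases i <;> fin_cases j <;> norm_num [addLegendreSym, Matrix.cons_val_zero, Matrix.cons_val_one, Matrix.cons_val_two, Matrix.cons_val_succ, Matrix.head_cons, Matrix.cons_val_fin_one])
    (by intro i; fin_cases i <;> norm_num [addLegendreSym, Matrix.cons_val_zero, Matrix.cons_val_one, Matrix.cons_val_two, Matrix.cons_val_succ, Matrix.head_cons, Matrix.cons_val_fin_one])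
    (by intro i; fin_cases i <;> norm_num [addLegendreSym, Matrix.cons_val_zero, Matrix.cons_val_one, Matrix.cons_val_two, Matrix.cons_val_succ, Matrix.head_cons, Matrix.cons_val_fin_one])
    (by decide)

/-- **`BSD(E_{136713}, 2)`** (`y² = x³ − 136713²x`, conductor `32·136713²`), journal door: Monsky (`hM`) + Burungale–Tian (`hBT`) + Deuring–Hecke (`hH`) + Burungale–Flach (`hBF`); membership `s(136713) = 0` by `det_monskyMatrixOdd_136713`. [cite: BurungaleTian2026, Thm. 1.1] [cite: BurungaleFlach2024, Cor. 2] [cite: Miller2011LMS, Def. 1.1] -/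
theorem bsdp_two_congruentNumberCurve_136713 (hM : monsky_card_selmerGroup_two_odd)
    (hBT : burungaleTian_analyticRank_eq_zero_of_selmerCorank_eq_zero_of_hasCM)
    (hH : hasEntireLFunction_of_j_mem_maximalCMJInvariants)
    (hBF : bsdTriple_of_hasCM_of_L_one_ne_zero) : BSDp (congruentNumberCurve 136713) 2 :=
  bsdp_two_congruentNumberCurve_of_det_odd ![3, 199, 229] hM hBT hH hBF
    (by intro i; fin_cases i <;> norm_num) (by intro i; fin_cases i <;> decide) (by decide)
    det_monskyMatrixOdd_136713 (by simp [Fin.prod_univ_succ])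

/-- `n = 189442` = 2 · 11 · 79 · 109: `n ≡ 2 (mod 8)`, conductor `16·189442²`; Monsky's matrix (even case, `k = 3`) has rows `101100;111010;111000;100111;000011;001111` and `det M = 1`, i.e. `s(189442) = 0` (table route: Legendre bits by `norm_num`, inverse certificate by `decide`). [cite: HeathBrown1994SelmerCongruentII, Appendix (Monsky), typescript p. 41 L20–L36] -/
theorem det_monskyMatrixEven_189442 : (monskyMatrixEven ![11, 79, 109]).det = 1 :=
  det_monskyMatrixEven_of_table ![11, 79, 109] ![![1, 1, 1], ![0, 1, 1], ![1, 1, 1]] ![1, 0, 1] ![1, 1, 0]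
    (Matrix.fromBlocks !![1, 0, 0; 0, 0, 1; 1, 0, 0] !![0, 1, 1; 1, 0, 1; 1, 1, 0] !![1, 0, 0; 0, 1, 1; 0, 1, 1] !![1, 0, 1; 0, 0, 0; 0, 1, 0])
    (by intro i j; fin_cases i <;> fin_cases j <;> norm_num [addLegendreSym, Matrix.cons_val_zero, Matrix.cons_val_one, Matrix.cons_val_two, Matrix.cons_val_succ, Matrix.head_cons, Matrix.cons_val_fin_one])
    (by intro i; fin_cases i <;> norm_num [addLegendreSym, Matrix.cons_val_zero, Matrix.cons_val_one, Matrix.cons_val_two, Matrix.cons_val_succ, Matrix.head_cons, Matrix.cons_val_fin_one])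
    (by intro i; fin_cases i <;> norm_num [addLegendreSym, Matrix.cons_val_zero, Matrix.cons_val_one, Matrix.cons_val_two, Matrix.cons_val_succ, Matrix.head_cons, Matrix.cons_val_fin_one])
    (by decide)

/-- **`BSD(E_{189442}, 2)`** (`y² = x³ − 189442²x`, conductor `16·189442²`), journal door: Monsky (`hM`) + Burungale–Tian (`hBT`) + Deuring–Hecke (`hH`) + Burungale–Flach (`hBF`); membership `s(189442) = 0` by `det_monskyMatrixEven_189442`. [cite: BurungaleTian2026, Thm. 1.1] [cite: BurungaleFlach2024, Cor. 2] [cite: Miller2011LMS, Def. 1.1] -/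
theorem bsdp_two_congruentNumberCurve_189442 (hM : monsky_card_selmerGroup_two_even)
    (hBT : burungaleTian_analyticRank_eq_zero_of_selmerCorank_eq_zero_of_hasCM)
    (hH : hasEntireLFunction_of_j_mem_maximalCMJInvariants)
    (hBF : bsdTriple_of_hasCM_of_L_one_ne_zero) : BSDp (congruentNumberCurve 189442) 2 :=
  bsdp_two_congruentNumberCurve_of_det_even ![11, 79, 109] hM hBT hH hBF
    (by intro i; fin_cases i <;> norm_num) (by intro i; fin_cases i <;> decide) (by decide)
    det_monskyMatrixEven_189442 (by simp [Fin.prod_univ_succ])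

/-- `n = 229530` = 2 · 3 · 5 · 7 · 1093: `n ≡ 2 (mod 8)`, conductor `16·229530²`; Monsky's matrix (even case, `k = 4`) has rows `01101000;10110000;01000010;01000000;10000100;01001011;00001100;00010100` and `det M = 1`, i.e. `s(229530) = 0` (table route: Legendre bits by `norm_num`, inverse certificate by `decide`). [cite: HeathBrown1994SelmerCongruentII, Appendix (Monsky), typescript p. 41 L20–L36] -/
theorem det_monskyMatrixEven_229530 : (monskyMatrixEven ![3, 5, 7, 1093]).det = 1 :=
  det_monskyMatrixEven_of_table ![3, 5, 7, 1093] ![![1, 1, 0, 0], ![1, 1, 1, 1], ![1, 1, 1, 0], ![0, 1, 0, 1]] ![1, 1, 0, 1] ![1, 0, 1, 0]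
    (Matrix.fromBlocks !![1, 1, 0, 1; 0, 0, 0, 1; 0, 1, 0, 0; 1, 1, 0, 1] !![0, 0, 1, 1; 0, 0, 0, 0; 1, 0, 0, 1; 1, 0, 1, 0] !![1, 1, 0, 1; 1, 1, 0, 1; 0, 0, 1, 1; 1, 1, 1, 1] !![1, 0, 0, 1; 1, 0, 1, 1; 0, 0, 0, 0; 1, 1, 0, 1])
    (by intro i j; fin_cases i <;> fin_cases j <;> norm_num [addLegendreSym, Matrix.cons_val_zero, Matrix.cons_val_one, Matrix.cons_val_two, Matrix.cons_val_succ, Matrix.head_cons, Matrix.cons_val_fin_one])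
    (by intro i; fin_cases i <;> norm_num [addLegendreSym, Matrix.cons_val_zero, Matrix.cons_val_one, Matrix.cons_val_two, Matrix.cons_val_succ, Matrix.head_cons, Matrix.cons_val_fin_one])
    (by intro i; fin_cases i <;> norm_num [addLegendreSym, Matrix.cons_val_zero, Matrix.cons_val_one, Matrix.cons_val_two, Matrix.cons_val_succ, Matrix.head_cons, Matrix.cons_val_fin_one])
    (by decide)

/-- **`BSD(E_{229530}, 2)`** (`y² = x³ − 229530²x`, conductor `16·229530²`), journal door: Monsky (`hM`) + Burungale–Tian (`hBT`) + Deuring–Hecke (`hH`) + Burungale–Flach (`hBF`); membership `s(229530) = 0` by `det_monskyMatrixEven_229530`. [cite: BurungaleTian2026, Thm. 1.1] [cite: BurungaleFlach2024, Cor. 2] [cite: Miller2011LMS, Def. 1.1] -/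
theorem bsdp_two_congruentNumberCurve_229530 (hM : monsky_card_selmerGroup_two_even)
    (hBT : burungaleTian_analyticRank_eq_zero_of_selmerCorank_eq_zero_of_hasCM)
    (hH : hasEntireLFunction_of_j_mem_maximalCMJInvariants)
    (hBF : bsdTriple_of_hasCM_of_L_one_ne_zero) : BSDp (congruentNumberCurve 229530) 2 :=
  bsdp_two_congruentNumberCurve_of_det_even ![3, 5, 7, 1093] hM hBT hH hBF
    (by intro i; fin_cases i <;> norm_num) (by intro i; fin_cases i <;> decide) (by decide)
    det_monskyMatrixEven_229530 (by simp [Fin.prod_univ_succ])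

/-- `n = 242169` = 3 · 89 · 907: `n ≡ 1 (mod 8)`, conductor `32·242169²`; Monsky's matrix (odd case, `k = 3`) has rows `010100;110000;100001;100110;000110;001101` and `det M = 1`, i.e. `s(242169) = 0` (table route: Legendre bits by `norm_num`, inverse certificate by `decide`). [cite: HeathBrown1994SelmerCongruentII, Appendix (Monsky), typescript p. 39 L10–L33] -/
theorem det_monskyMatrixOdd_242169 : (monskyMatrixOdd ![3, 89, 907]).det = 1 :=
  det_monskyMatrixOdd_of_table ![3, 89, 907] ![![1, 1, 0], ![1, 1, 0], ![1, 0, 1]] ![1, 0, 1] ![0, 0, 0]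
    (Matrix.fromBlocks !![0, 0, 0; 0, 1, 0; 1, 1, 1] !![1, 1, 0; 1, 1, 0; 0, 0, 1] !![1, 1, 0; 1, 1, 0; 0, 0, 1] !![1, 1, 0; 1, 0, 0; 1, 1, 0])
    (by intro i j; fin_cases i <;> fin_cases j <;> norm_num [addLegendreSym, Matrix.cons_val_zero, Matrix.cons_val_one, Matrix.cons_val_two, Matrix.cons_val_succ, Matrix.head_cons, Matrix.cons_val_fin_one])
    (by intro i; fin_cases i <;> norm_num [addLegendreSym, Matrix.cons_val_zero, Matrix.cons_val_one, Matrix.cons_val_two, Matrix.cons_val_succ, Matrix.head_cons, Matrix.cons_val_fin_one])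
    (by intro i; fin_cases i <;> norm_num [addLegendreSym, Matrix.cons_val_zero, Matrix.cons_val_one, Matrix.cons_val_two, Matrix.cons_val_succ, Matrix.head_cons, Matrix.cons_val_fin_one])
    (by decide)

/-- **`BSD(E_{242169}, 2)`** (`y² = x³ − 242169²x`, conductor `32·242169²`), journal door: Monsky (`hM`) + Burungale–Tian (`hBT`) + Deuring–Hecke (`hH`) + Burungale–Flach (`hBF`); membership `s(242169) = 0` by `det_monskyMatrixOdd_242169`. [cite: BurungaleTian2026, Thm. 1.1] [cite: BurungaleFlach2024, Cor. 2] [cite: Miller2011LMS, Def. 1.1] -/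
theorem bsdp_two_congruentNumberCurve_242169 (hM : monsky_card_selmerGroup_two_odd)
    (hBT : burungaleTian_analyticRank_eq_zero_of_selmerCorank_eq_zero_of_hasCM)
    (hH : hasEntireLFunction_of_j_mem_maximalCMJInvariants)
    (hBF : bsdTriple_of_hasCM_of_L_one_ne_zero) : BSDp (congruentNumberCurve 242169) 2 :=
  bsdp_two_congruentNumberCurve_of_det_odd ![3, 89, 907] hM hBT hH hBF
    (by intro i; fin_cases i <;> norm_num) (by intro i; fin_cases i <;> decide) (by decide)
    det_monskyMatrixOdd_242169 (by simp [Fin.prod_univ_succ])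

/-- `n = 293995` = 5 · 13 · 4523: `n ≡ 3 (mod 8)`, conductor `32·293995²`; Monsky's matrix (odd case, `k = 3`) has rows `111100;100010;100001;100111;010100;001101` and `det M = 1`, i.e. `s(293995) = 0` (table route: Legendre bits by `norm_num`, inverse certificate by `decide`). [cite: HeathBrown1994SelmerCongruentII, Appendix (Monsky), typescript p. 39 L10–L33] -/
theorem det_monskyMatrixOdd_293995 : (monskyMatrixOdd ![5, 13, 4523]).det = 1 :=
  det_monskyMatrixOdd_of_table ![5, 13, 4523] ![![1, 1, 1], ![1, 1, 0], ![1, 0, 1]] ![1, 1, 1] ![1, 1, 0]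
    (Matrix.fromBlocks !![1, 1, 0; 1, 0, 1; 0, 1, 0] !![1, 1, 1; 0, 0, 1; 1, 0, 1] !![1, 0, 1; 1, 0, 0; 1, 1, 1] !![0, 1, 1; 1, 1, 1; 1, 1, 1])
    (by intro i j; fin_cases i <;> fin_cases j <;> norm_num [addLegendreSym, Matrix.cons_val_zero, Matrix.cons_val_one, Matrix.cons_val_two, Matrix.cons_val_succ, Matrix.head_cons, Matrix.cons_val_fin_one])
    (by intro i; fin_cases i <;> norm_num [addLegendreSym, Matrix.cons_val_zero, Matrix.cons_val_one, Matrix.cons_val_two, Matrix.cons_val_succ, Matrix.head_cons, Matrix.cons_val_fin_one])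
    (by intro i; fin_cases i <;> norm_num [addLegendreSym, Matrix.cons_val_zero, Matrix.cons_val_one, Matrix.cons_val_two, Matrix.cons_val_succ, Matrix.head_cons, Matrix.cons_val_fin_one])
    (by decide)

/-- **`BSD(E_{293995}, 2)`** (`y² = x³ − 293995²x`, conductor `32·293995²`), journal door: Monsky (`hM`) + Burungale–Tian (`hBT`) + Deuring–Hecke (`hH`) + Burungale–Flach (`hBF`); membership `s(293995) = 0` by `det_monskyMatrixOdd_293995`. [cite: BurungaleTian2026, Thm. 1.1] [cite: BurungaleFlach2024, Cor. 2] [cite: Miller2011LMS, Def. 1.1] -/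
theorem bsdp_two_congruentNumberCurve_293995 (hM : monsky_card_selmerGroup_two_odd)
    (hBT : burungaleTian_analyticRank_eq_zero_of_selmerCorank_eq_zero_of_hasCM)
    (hH : hasEntireLFunction_of_j_mem_maximalCMJInvariants)
    (hBF : bsdTriple_of_hasCM_of_L_one_ne_zero) : BSDp (congruentNumberCurve 293995) 2 :=
  bsdp_two_congruentNumberCurve_of_det_odd ![5, 13, 4523] hM hBT hH hBF
    (by intro i; fin_cases i <;> norm_num) (by intro i; fin_cases i <;> decide) (by decide)
    det_monskyMatrixOdd_293995 (by simp [Fin.prod_univ_succ])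

/-- `n = 345466` = 2 · 11 · 41 · 383: `n ≡ 2 (mod 8)`, conductor `16·345466²`; Monsky's matrix (even case, `k = 3`) has rows `011100;101000;010001;100010;000101;000110` and `det M = 1`, i.e. `s(345466) = 0` (table route: Legendre bits by `norm_num`, inverse certificate by `decide`). [cite: HeathBrown1994SelmerCongruentII, Appendix (Monsky), typescript p. 41 L20–L36] -/
theorem det_monskyMatrixEven_345466 : (monskyMatrixEven ![11, 41, 383]).det = 1 :=
  det_monskyMatrixEven_of_table ![11, 41, 383] ![![1, 1, 0], ![1, 1, 1], ![1, 1, 1]] ![1, 0, 0] ![1, 0, 1]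
    (Matrix.fromBlocks !![1, 1, 1; 1, 1, 0; 1, 0, 1] !![0, 1, 0; 1, 0, 1; 0, 1, 0] !![1, 1, 1; 1, 1, 1; 1, 1, 1] !![1, 1, 1; 1, 1, 0; 1, 0, 1])
    (by intro i j; fin_cases i <;> fin_cases j <;> norm_num [addLegendreSym, Matrix.cons_val_zero, Matrix.cons_val_one, Matrix.cons_val_two, Matrix.cons_val_succ, Matrix.head_cons, Matrix.cons_val_fin_one])
    (by intro i; fin_cases i <;> norm_num [addLegendreSym, Matrix.cons_val_zero, Matrix.cons_val_one, Matrix.cons_val_two, Matrix.cons_val_succ, Matrix.head_cons, Matrix.cons_val_fin_one])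
    (by intro i; fin_cases i <;> norm_num [addLegendreSym, Matrix.cons_val_zero, Matrix.cons_val_one, Matrix.cons_val_two, Matrix.cons_val_succ, Matrix.head_cons, Matrix.cons_val_fin_one])
    (by decide)

/-- **`BSD(E_{345466}, 2)`** (`y² = x³ − 345466²x`, conductor `16·345466²`), journal door: Monsky (`hM`) + Burungale–Tian (`hBT`) + Deuring–Hecke (`hH`) + Burungale–Flach (`hBF`); membership `s(345466) = 0` by `det_monskyMatrixEven_345466`. [cite: BurungaleTian2026, Thm. 1.1] [cite: BurungaleFlach2024, Cor. 2] [cite: Miller2011LMS, Def. 1.1] -/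
theorem bsdp_two_congruentNumberCurve_345466 (hM : monsky_card_selmerGroup_two_even)
    (hBT : burungaleTian_analyticRank_eq_zero_of_selmerCorank_eq_zero_of_hasCM)
    (hH : hasEntireLFunction_of_j_mem_maximalCMJInvariants)
    (hBF : bsdTriple_of_hasCM_of_L_one_ne_zero) : BSDp (congruentNumberCurve 345466) 2 :=
  bsdp_two_congruentNumberCurve_of_det_even ![11, 41, 383] hM hBT hH hBF
    (by intro i; fin_cases i <;> norm_num) (by intro i; fin_cases i <;> decide) (by decide)
    det_monskyMatrixEven_345466 (by simp [Fin.prod_univ_succ])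

/-- `n = 350715` = 3 · 5 · 103 · 227: `n ≡ 3 (mod 8)`, conductor `32·350715²`; Monsky's matrix (odd case, `k = 4`) has rows `11011000;10110100;11110000;01000001;10000101;01001011;00001101;00010101` and `det M = 1`, i.e. `s(350715) = 0` (table route: Legendre bits by `norm_num`, inverse certificate by `decide`). [cite: HeathBrown1994SelmerCongruentII, Appendix (Monsky), typescript p. 39 L10–L33] -/
theorem det_monskyMatrixOdd_350715 : (monskyMatrixOdd ![3, 5, 103, 227]).det = 1 :=
  det_monskyMatrixOdd_of_table ![3, 5, 103, 227] ![![1, 1, 0, 1], ![1, 1, 1, 1], ![1, 1, 1, 1], ![0, 1, 0, 1]] ![1, 1, 0, 1] ![0, 1, 1, 0]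
    (Matrix.fromBlocks !![0, 1, 1, 1; 1, 1, 1, 1; 1, 1, 0, 1; 0, 1, 1, 1] !![1, 0, 0, 0; 1, 0, 1, 1; 0, 0, 1, 0; 0, 0, 0, 1] !![0, 1, 1, 1; 1, 0, 0, 1; 0, 1, 1, 0; 1, 1, 1, 0] !![0, 0, 1, 0; 1, 0, 1, 1; 0, 1, 1, 0; 1, 0, 1, 1])
    (by intro i j; fin_cases i <;> fin_cases j <;> norm_num [addLegendreSym, Matrix.cons_val_zero, Matrix.cons_val_one, Matrix.cons_val_two, Matrix.cons_val_succ, Matrix.head_cons, Matrix.cons_val_fin_one])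
    (by intro i; fin_cases i <;> norm_num [addLegendreSym, Matrix.cons_val_zero, Matrix.cons_val_one, Matrix.cons_val_two, Matrix.cons_val_succ, Matrix.head_cons, Matrix.cons_val_fin_one])
    (by intro i; fin_cases i <;> norm_num [addLegendreSym, Matrix.cons_val_zero, Matrix.cons_val_one, Matrix.cons_val_two, Matrix.cons_val_succ, Matrix.head_cons, Matrix.cons_val_fin_one])
    (by decide)

/-- **`BSD(E_{350715}, 2)`** (`y² = x³ − 350715²x`, conductor `32·350715²`), journal door: Monsky (`hM`) + Burungale–Tian (`hBT`) + Deuring–Hecke (`hH`) + Burungale–Flach (`hBF`); membership `s(350715) = 0` by `det_monskyMatrixOdd_350715`. [cite: BurungaleTian2026, Thm. 1.1] [cite: BurungaleFlach2024, Cor. 2] [cite: Miller2011LMS, Def. 1.1] -/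
theorem bsdp_two_congruentNumberCurve_350715 (hM : monsky_card_selmerGroup_two_odd)
    (hBT : burungaleTian_analyticRank_eq_zero_of_selmerCorank_eq_zero_of_hasCM)
    (hH : hasEntireLFunction_of_j_mem_maximalCMJInvariants)
    (hBF : bsdTriple_of_hasCM_of_L_one_ne_zero) : BSDp (congruentNumberCurve 350715) 2 :=
  bsdp_two_congruentNumberCurve_of_det_odd ![3, 5, 103, 227] hM hBT hH hBF
    (by intro i; fin_cases i <;> norm_num) (by intro i; fin_cases i <;> decide) (by decide)
    det_monskyMatrixOdd_350715 (by simp [Fin.prod_univ_succ])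

/-- `n = 396019` = 13 · 41 · 743: `n ≡ 3 (mod 8)`, conductor `32·396019²`; Monsky's matrix (odd case, `k = 3`) has rows `111100;110000;101000;100111;000110;000100` and `det M = 1`, i.e. `s(396019) = 0` (table route: Legendre bits by `norm_num`, inverse certificate by `decide`). [cite: HeathBrown1994SelmerCongruentII, Appendix (Monsky), typescript p. 39 L10–L33] -/
theorem det_monskyMatrixOdd_396019 : (monskyMatrixOdd ![13, 41, 743]).det = 1 :=
  det_monskyMatrixOdd_of_table ![13, 41, 743] ![![1, 1, 1], ![1, 1, 0], ![1, 0, 1]] ![1, 0, 0] ![1, 0, 1]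
    (Matrix.fromBlocks !![1, 1, 1; 1, 0, 1; 1, 1, 0] !![0, 0, 1; 0, 0, 1; 0, 0, 1] !![0, 0, 0; 0, 0, 0; 1, 1, 1] !![0, 0, 1; 0, 1, 1; 1, 1, 1])
    (by intro i j; fin_cases i <;> fin_cases j <;> norm_num [addLegendreSym, Matrix.cons_val_zero, Matrix.cons_val_one, Matrix.cons_val_two, Matrix.cons_val_succ, Matrix.head_cons, Matrix.cons_val_fin_one])
    (by intro i; fin_cases i <;> norm_num [addLegendreSym, Matrix.cons_val_zero, Matrix.cons_val_one, Matrix.cons_val_two, Matrix.cons_val_succ, Matrix.head_cons, Matrix.cons_val_fin_one])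
    (by intro i; fin_cases i <;> norm_num [addLegendreSym, Matrix.cons_val_zero, Matrix.cons_val_one, Matrix.cons_val_two, Matrix.cons_val_succ, Matrix.head_cons, Matrix.cons_val_fin_one])
    (by decide)

/-- **`BSD(E_{396019}, 2)`** (`y² = x³ − 396019²x`, conductor `32·396019²`), journal door: Monsky (`hM`) + Burungale–Tian (`hBT`) + Deuring–Hecke (`hH`) + Burungale–Flach (`hBF`); membership `s(396019) = 0` by `det_monskyMatrixOdd_396019`. [cite: BurungaleTian2026, Thm. 1.1] [cite: BurungaleFlach2024, Cor. 2] [cite: Miller2011LMS, Def. 1.1] -/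
theorem bsdp_two_congruentNumberCurve_396019 (hM : monsky_card_selmerGroup_two_odd)
    (hBT : burungaleTian_analyticRank_eq_zero_of_selmerCorank_eq_zero_of_hasCM)
    (hH : hasEntireLFunction_of_j_mem_maximalCMJInvariants)
    (hBF : bsdTriple_of_hasCM_of_L_one_ne_zero) : BSDp (congruentNumberCurve 396019) 2 :=
  bsdp_two_congruentNumberCurve_of_det_odd ![13, 41, 743] hM hBT hH hBF
    (by intro i; fin_cases i <;> norm_num) (by intro i; fin_cases i <;> decide) (by decide)
    det_monskyMatrixOdd_396019 (by simp [Fin.prod_univ_succ])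

/-- `n = 441210` = 2 · 3 · 5 · 7 · 11 · 191: `n ≡ 2 (mod 8)`, conductor `16·441210²`; Monsky's matrix (even case, `k = 5`) has rows `0110010000;1110000000;0101100100;1000100010;1000000001;1000001011;0100011100;0000011000;0001000100;0000000110` and `det M = 1`, i.e. `s(441210) = 0` (table route: Legendre bits by `norm_num`, inverse certificate by `decide`). [cite: HeathBrown1994SelmerCongruentII, Appendix (Monsky), typescript p. 41 L20–L36] -/
theorem det_monskyMatrixEven_441210 : (monskyMatrixEven ![3, 5, 7, 11, 191]).det = 1 :=
  det_monskyMatrixEven_of_table ![3, 5, 7, 11, 191] ![![1, 1, 0, 1, 1], ![1, 1, 1, 0, 0], ![1, 1, 1, 0, 0], ![0, 0, 1, 1, 0], ![0, 0, 1, 1, 1]] ![1, 1, 0, 1, 0] ![1, 0, 1, 1, 1]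
    (Matrix.fromBlocks !![0, 0, 1, 1, 0; 1, 1, 1, 1, 1; 1, 0, 0, 0, 1; 1, 1, 1, 1, 1; 1, 1, 0, 1, 1] !![0, 1, 1, 1, 1; 1, 0, 1, 1, 0; 1, 1, 0, 0, 1; 1, 1, 0, 0, 0; 1, 0, 1, 0, 0] !![1, 1, 1, 1, 0; 1, 1, 1, 1, 0; 1, 1, 1, 1, 1; 1, 1, 1, 1, 1; 0, 0, 1, 1, 1] !![0, 1, 1, 1, 1; 0, 1, 0, 1, 1; 1, 1, 0, 1, 0; 1, 1, 0, 1, 1; 0, 1, 1, 1, 1])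
    (by intro i j; fin_cases i <;> fin_cases j <;> norm_num [addLegendreSym, Matrix.cons_val_zero, Matrix.cons_val_one, Matrix.cons_val_two, Matrix.cons_val_succ, Matrix.head_cons, Matrix.cons_val_fin_one])
    (by intro i; fin_cases i <;> norm_num [addLegendreSym, Matrix.cons_val_zero, Matrix.cons_val_one, Matrix.cons_val_two, Matrix.cons_val_succ, Matrix.head_cons, Matrix.cons_val_fin_one])
    (by intro i; fin_cases i <;> norm_num [addLegendreSym, Matrix.cons_val_zero, Matrix.cons_val_one, Matrix.cons_val_two, Matrix.cons_val_succ, Matrix.head_cons, Matrix.cons_val_fin_one])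
    (by decide)

/-- **`BSD(E_{441210}, 2)`** (`y² = x³ − 441210²x`, conductor `16·441210²`), journal door: Monsky (`hM`) + Burungale–Tian (`hBT`) + Deuring–Hecke (`hH`) + Burungale–Flach (`hBF`); membership `s(441210) = 0` by `det_monskyMatrixEven_441210`. [cite: BurungaleTian2026, Thm. 1.1] [cite: BurungaleFlach2024, Cor. 2] [cite: Miller2011LMS, Def. 1.1] -/
theorem bsdp_two_congruentNumberCurve_441210 (hM : monsky_card_selmerGroup_two_even)
    (hBT : burungaleTian_analyticRank_eq_zero_of_selmerCorank_eq_zero_of_hasCM)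
    (hH : hasEntireLFunction_of_j_mem_maximalCMJInvariants)
    (hBF : bsdTriple_of_hasCM_of_L_one_ne_zero) : BSDp (congruentNumberCurve 441210) 2 :=
  bsdp_two_congruentNumberCurve_of_det_even ![3, 5, 7, 11, 191] hM hBT hH hBF
    (by intro i; fin_cases i <;> norm_num) (by intro i; fin_cases i <;> decide) (by decide)
    det_monskyMatrixEven_441210 (by simp [Fin.prod_univ_succ])

/-- `n = 445811` = 31 · 73 · 197: `n ≡ 3 (mod 8)`, conductor `32·445811²`; Monsky's matrix (odd case, `k = 3`) has rows `011000;101000;111001;000111;000101;001111` and `det M = 1`, i.e. `s(445811) = 0` (table route: Legendre bits by `norm_num`, inverse certificate by `decide`). [cite: HeathBrown1994SelmerCongruentII, Appendix (Monsky), typescript p. 39 L10–L33] -/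
theorem det_monskyMatrixOdd_445811 : (monskyMatrixOdd ![31, 73, 197]).det = 1 :=
  det_monskyMatrixOdd_of_table ![31, 73, 197] ![![1, 1, 1], ![1, 1, 1], ![1, 1, 1]] ![0, 0, 1] ![1, 0, 1]
    (Matrix.fromBlocks !![0, 1, 0; 1, 0, 0; 0, 0, 0] !![1, 0, 1; 1, 0, 1; 1, 0, 1] !![1, 1, 1; 0, 0, 0; 1, 1, 1] !![1, 1, 1; 1, 1, 0; 1, 0, 1])
    (by intro i j; fin_cases i <;> fin_cases j <;> norm_num [addLegendreSym, Matrix.cons_val_zero, Matrix.cons_val_one, Matrix.cons_val_two, Matrix.cons_val_succ, Matrix.head_cons, Matrix.cons_val_fin_one])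
    (by intro i; fin_cases i <;> norm_num [addLegendreSym, Matrix.cons_val_zero, Matrix.cons_val_one, Matrix.cons_val_two, Matrix.cons_val_succ, Matrix.head_cons, Matrix.cons_val_fin_one])
    (by intro i; fin_cases i <;> norm_num [addLegendreSym, Matrix.cons_val_zero, Matrix.cons_val_one, Matrix.cons_val_two, Matrix.cons_val_succ, Matrix.head_cons, Matrix.cons_val_fin_one])
    (by decide)

/-- **`BSD(E_{445811}, 2)`** (`y² = x³ − 445811²x`, conductor `32·445811²`), journal door: Monsky (`hM`) + Burungale–Tian (`hBT`) + Deuring–Hecke (`hH`) + Burungale–Flach (`hBF`); membership `s(445811) = 0` by `det_monskyMatrixOdd_445811`. [cite: BurungaleTian2026, Thm. 1.1] [cite: BurungaleFlach2024, Cor. 2] [cite: Miller2011LMS, Def. 1.1] -/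
theorem bsdp_two_congruentNumberCurve_445811 (hM : monsky_card_selmerGroup_two_odd)
    (hBT : burungaleTian_analyticRank_eq_zero_of_selmerCorank_eq_zero_of_hasCM)
    (hH : hasEntireLFunction_of_j_mem_maximalCMJInvariants)
    (hBF : bsdTriple_of_hasCM_of_L_one_ne_zero) : BSDp (congruentNumberCurve 445811) 2 :=
  bsdp_two_congruentNumberCurve_of_det_odd ![31, 73, 197] hM hBT hH hBF
    (by intro i; fin_cases i <;> norm_num) (by intro i; fin_cases i <;> decide) (by decide)
    det_monskyMatrixOdd_445811 (by simp [Fin.prod_univ_succ])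

/-- `n = 466890` = 2 · 3 · 5 · 79 · 197: `n ≡ 2 (mod 8)`, conductor `16·466890²`; Monsky's matrix (even case, `k = 4`) has rows `11111000;11010000;00010010;11100000;10001101;01001101;00001001;00011110` and `det M = 1`, i.e. `s(466890) = 0` (table route: Legendre bits by `norm_num`, inverse certificate by `decide`). [cite: HeathBrown1994SelmerCongruentII, Appendix (Monsky), typescript p. 41 L20–L36] -/
theorem det_monskyMatrixEven_466890 : (monskyMatrixEven ![3, 5, 79, 197]).det = 1 :=
  det_monskyMatrixEven_of_table ![3, 5, 79, 197] ![![1, 1, 0, 1], ![1, 1, 0, 1], ![1, 0, 1, 1], ![1, 1, 1, 1]] ![1, 1, 0, 1] ![1, 0, 1, 0]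
    (Matrix.fromBlocks !![1, 1, 1, 1; 1, 1, 1, 1; 0, 0, 0, 1; 0, 1, 0, 0] !![0, 1, 1, 1; 1, 0, 1, 1; 1, 1, 0, 0; 1, 1, 0, 0] !![1, 1, 0, 1; 1, 1, 1, 1; 0, 1, 1, 0; 1, 1, 0, 1] !![1, 1, 0, 0; 1, 1, 0, 1; 1, 1, 0, 0; 1, 1, 1, 0])
    (by intro i j; fin_cases i <;> fin_cases j <;> norm_num [addLegendreSym, Matrix.cons_val_zero, Matrix.cons_val_one, Matrix.cons_val_two, Matrix.cons_val_succ, Matrix.head_cons, Matrix.cons_val_fin_one])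
    (by intro i; fin_cases i <;> norm_num [addLegendreSym, Matrix.cons_val_zero, Matrix.cons_val_one, Matrix.cons_val_two, Matrix.cons_val_succ, Matrix.head_cons, Matrix.cons_val_fin_one])
    (by intro i; fin_cases i <;> norm_num [addLegendreSym, Matrix.cons_val_zero, Matrix.cons_val_one, Matrix.cons_val_two, Matrix.cons_val_succ, Matrix.head_cons, Matrix.cons_val_fin_one])
    (by decide)

/-- **`BSD(E_{466890}, 2)`** (`y² = x³ − 466890²x`, conductor `16·466890²`), journal door: Monsky (`hM`) + Burungale–Tian (`hBT`) + Deuring–Hecke (`hH`) + Burungale–Flach (`hBF`); membership `s(466890) = 0` by `det_monskyMatrixEven_466890`. [cite: BurungaleTian2026, Thm. 1.1] [cite: BurungaleFlach2024, Cor. 2] [cite: Miller2011LMS, Def. 1.1] -/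
theorem bsdp_two_congruentNumberCurve_466890 (hM : monsky_card_selmerGroup_two_even)
    (hBT : burungaleTian_analyticRank_eq_zero_of_selmerCorank_eq_zero_of_hasCM)
    (hH : hasEntireLFunction_of_j_mem_maximalCMJInvariants)
    (hBF : bsdTriple_of_hasCM_of_L_one_ne_zero) : BSDp (congruentNumberCurve 466890) 2 :=
  bsdp_two_congruentNumberCurve_of_det_even ![3, 5, 79, 197] hM hBT hH hBF
    (by intro i; fin_cases i <;> norm_num) (by intro i; fin_cases i <;> decide) (by decide)
    det_monskyMatrixEven_466890 (by simp [Fin.prod_univ_succ])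

end Summit.BirchSwinnertonDyer.Rank1Residual.P2

end
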